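import Mathlib
import HarnessLib

/-!
# The number of zero-patterns of a sequence of polynomials (Rónyai–Babai–Ganapathy 2001)

Topic `Literature/Combinatorics`. Let `f_1, …, f_m ∈ F[x_σ]` be polynomials over a field with
`Σ_i deg f_i ≤ D`. The **zero-pattern** (here recorded by its complement, the *support pattern*)
of a point `v ∈ F^σ` is the set of indices `i` with `f_i(v) ≠ 0`. **Theorem 1.1 of
Rónyai–Babai–Ganapathy** (J. AMS 14 (2001)): the number of zero-patterns, as `v` ranges over
`F^σ`, is at most the number of monomials of degree `≤ D` in the variables `σ` (`= binom(n + D, n)`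
for `n` variables; recorded here in the monomial-count form `card (degreeLEMonomials σ D)` and in
the crude form `(D+1)^n`, `card_degreeLEMonomials_le_pow`).

Proof (the paper's, one paragraph): choose a witness `v_S` for each pattern `S`; the products
`g_S = Π_{i ∈ S} f_i` have degree `≤ D`, `g_S(v_S) ≠ 0`, and `g_S(v_T) = 0` unless `S ⊆ T`; hence
the vectors `(g_S(v_T))_T` are linearly independent (a pattern of minimal size in a vanishing
combination gives a contradiction), while they lie in the span of the `#(monomials of degree ≤ D)`
vectors `(v_T^e)_T` — so there are at most that many patterns.

* `RBG.supportPattern f v` — the set of indices `i` with `f_i(v) ≠ 0`;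
* `RBG.patterns f` — the (finite) set of realised patterns;
* `RBG.card_patterns_le` — **Thm. 1.1**: `#patterns ≤ #degreeLEMonomials σ D` whenever
  `Σ_i deg f_i ≤ D`; `RBG.card_patterns_le_pow` — `≤ (D+1)^(#σ)`.

## References

* [RonyaiBabaiGanapathy2001] L. Rónyai, L. Babai, M. K. Ganapathy, *On the number of
  zero-patterns of a sequence of polynomials*, J. Amer. Math. Soc. 14 (2001) 717–735, Thm. 1.1.
-/

noncomputable section

open MvPolynomial Finset

namespace Literature.Combinatorics

namespace RBG

variable {F : Type*} [Field F] {σ : Type*} {ι : Type*} [Fintype ι]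

/-- The support pattern of the point `v`: the indices `i` with `f_i(v) ≠ 0` (the complement of
the zero-pattern `δ(f, v)` of the paper). [cite: RonyaiBabaiGanapathy2001, §1 (Def. of zero-pattern)] -/
def supportPattern (f : ι → MvPolynomial σ F) (v : σ → F) : Finset ι :=
  open scoped Classical in Finset.univ.filter fun i => eval v (f i) ≠ 0

/-- The set of realised patterns `{δ(f, v) : v ∈ F^σ}` (finite: a subset of the power set of the
index set). [cite: RonyaiBabaiGanapathy2001, §1 (the number `Z_F(f)`)] -/
def patterns (f : ι → MvPolynomial σ F) : Finset (Finset ι) :=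
  open scoped Classical in Finset.univ.filter fun S => ∃ v : σ → F, supportPattern f v = S

/-- Membership in the support pattern. [cite: RonyaiBabaiGanapathy2001, §1] -/
@[simp] theorem mem_supportPattern (f : ι → MvPolynomial σ F) (v : σ → F) (i : ι) :
    i ∈ supportPattern f v ↔ eval v (f i) ≠ 0 := by
  classical
  simp [supportPattern]

/-- Every point realises a pattern. [cite: RonyaiBabaiGanapathy2001, §1] -/
theorem supportPattern_mem_patterns (f : ι → MvPolynomial σ F) (v : σ → F) :
    supportPattern f v ∈ patterns f := by
  classical
  unfold patterns
  rw [Finset.mem_filter]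
  exact ⟨Finset.mem_univ _, v, rfl⟩

/-- The monomials of degree `≤ D` in finitely many variables `σ`, as a finite set of exponent
vectors. [cite: RonyaiBabaiGanapathy2001, §1 (the count `binom(n+D, n)`)] -/
def degreeLEMonomials (σ : Type*) [Fintype σ] [DecidableEq σ] (D : ℕ) : Finset (σ →₀ ℕ) :=
  (Finset.range (D + 1)).biUnion fun k => (Finset.univ : Finset σ).finsuppAntidiag k

/-- An exponent vector of degree `≤ D` is one of the listed monomials. [folklore] -/
private theorem mem_degreeLEMonomials_of_sum_le [Fintype σ] [DecidableEq σ] {D : ℕ}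
    {e : σ →₀ ℕ} (he : (e.sum fun _ k => k) ≤ D) : e ∈ degreeLEMonomials σ D := by
  simp only [degreeLEMonomials, Finset.mem_biUnion, Finset.mem_range]
  have hsum : (e.sum fun _ k => k) = Finset.univ.sum e := Finsupp.sum_fintype e _ (fun _ => rfl)
  refine ⟨Finset.univ.sum e, by omega, ?_⟩
  rw [Finset.mem_finsuppAntidiag]
  exact ⟨rfl, Finset.subset_univ _⟩

/-- Crude count: at most `(D+1)^(#σ)` monomials of degree `≤ D` (each exponent is `≤ D`).
[cite: RonyaiBabaiGanapathy2001, §1 (remark after Thm. 1.1)] -/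
theorem card_degreeLEMonomials_le_pow (σ : Type*) [Fintype σ] [DecidableEq σ] (D : ℕ) :
    (degreeLEMonomials σ D).card ≤ (D + 1) ^ Fintype.card σ := by
  classical
  have key : ∀ e ∈ degreeLEMonomials σ D, ∀ i, e i < D + 1 := by
    intro e he i
    simp only [degreeLEMonomials, Finset.mem_biUnion, Finset.mem_range,
      Finset.mem_finsuppAntidiag] at he
    obtain ⟨k, hk, hsum, -⟩ := he
    have : e i ≤ Finset.univ.sum e :=
      Finset.single_le_sum (fun j _ => Nat.zero_le (e j)) (Finset.mem_univ i)
    omega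
  let φ : (σ →₀ ℕ) → (σ → Fin (D + 1)) := fun e i =>
    if h : e i < D + 1 then ⟨e i, h⟩ else ⟨0, Nat.succ_pos D⟩
  calc (degreeLEMonomials σ D).card
      ≤ (Finset.univ : Finset (σ → Fin (D + 1))).card := by
        refine Finset.card_le_card_of_injOn φ (fun _ _ => Finset.mem_univ _) ?_
        intro e he e' he' h
        ext i
        have h1 := key e he i
        have h2 := key e' he' i
        have := congrFun h i
        simp only [φ, dif_pos h1, dif_pos h2, Fin.mk.injEq] at this
        exact this
    _ = (D + 1) ^ Fintype.card σ := by simp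

/-! ### The products `g_S = Π_{i ∈ S} f_i` -/

/-- `g_S(v_T) ≠ 0` iff `S ⊆ δ(v_T)`: the product over `S` is nonzero at `v` exactly when every
`f_i`, `i ∈ S`, is nonzero at `v`. [cite: RonyaiBabaiGanapathy2001, proof of Thm. 1.1] -/
theorem eval_prod_ne_zero_iff (f : ι → MvPolynomial σ F) (S : Finset ι) (v : σ → F) :
    eval v (∏ i ∈ S, f i) ≠ 0 ↔ S ⊆ supportPattern f v := by
  rw [map_prod, Finset.prod_ne_zero_iff]
  simp only [Finset.subset_iff, mem_supportPattern]

/-- The degree of `g_S` is at most `Σ_i deg f_i`. [cite: RonyaiBabaiGanapathy2001, proof of Thm. 1.1] -/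
theorem totalDegree_prod_le_sum (f : ι → MvPolynomial σ F) (S : Finset ι) :
    (∏ i ∈ S, f i).totalDegree ≤ ∑ i, (f i).totalDegree :=
  (totalDegree_finsetProd _ _).trans
    (Finset.sum_le_sum_of_subset_of_nonneg (Finset.subset_univ S) fun _ _ _ => Nat.zero_le _)

/-! ### Theorem 1.1 -/

/-- **Rónyai–Babai–Ganapathy, Thm. 1.1 (monomial-count form).** If `Σ_i deg f_i ≤ D` then the
number of zero-patterns of `f = (f_i)_{i ∈ ι}` over the field `F` is at most the number of
monomials of degree `≤ D` in the variables `σ` (`= binom(n + D, n)` for `n = #σ`). Printed: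
"the number of zero-patterns of `f` is at most `binom(n + D, n)`" where `D = Σ d_i`, `deg f_i ≤ d_i`.
[cite: RonyaiBabaiGanapathy2001, Thm. 1.1] -/
theorem card_patterns_le [Fintype σ] [DecidableEq σ] (f : ι → MvPolynomial σ F) {D : ℕ}
    (hD : ∑ i, (f i).totalDegree ≤ D) :
    (patterns f).card ≤ (degreeLEMonomials σ D).card := by
  classical
  -- witnesses
  have hw : ∀ S : patterns f, ∃ v : σ → F, supportPattern f v = S := fun S => by
    have hS := S.2
    unfold patterns at hS
    rw [Finset.mem_filter] at hS
    exact hS.2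
  choose w hw using hw
  -- the products and their evaluation vectors in `F^(patterns f)`
  let g : patterns f → MvPolynomial σ F := fun S => ∏ i ∈ (S : Finset ι), f i
  let vec : patterns f → (patterns f → F) := fun S T => eval (w T) (g S)
  have hdiag : ∀ S : patterns f, vec S S ≠ 0 := fun S => by
    simp only [vec, g]
    rw [eval_prod_ne_zero_iff, hw S]
  have hoff : ∀ S T : patterns f, S ≠ T → (T : Finset ι).card ≤ (S : Finset ι).card →
      vec S T = 0 := by
    intro S T hST hcard
    by_contra hne
    have hsub : (S : Finset ι) ⊆ supportPattern f (w T) :=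
      (eval_prod_ne_zero_iff f _ (w T)).mp hne
    rw [hw T] at hsub
    exact hST (Subtype.ext (Finset.eq_of_subset_of_card_le hsub hcard))
  -- linear independence: a vanishing combination has no nonzero coefficient of minimal size
  have hli : LinearIndependent F vec := by
    rw [Fintype.linearIndependent_iff]
    intro c hc
    by_contra hcon
    push Not at hcon
    obtain ⟨S₀, hS₀, hmin⟩ : ∃ S₀ : patterns f, c S₀ ≠ 0 ∧
        ∀ S : patterns f, c S ≠ 0 → (S₀ : Finset ι).card ≤ (S : Finset ι).card := by
      let bad := (Finset.univ : Finset (patterns f)).filter fun S => c S ≠ 0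
      have hne : bad.Nonempty := by
        obtain ⟨S, hS⟩ := hcon
        exact ⟨S, Finset.mem_filter.mpr ⟨Finset.mem_univ _, hS⟩⟩
      obtain ⟨S₀, hS₀mem, hS₀min⟩ :=
        bad.exists_min_image (fun S => (S : Finset ι).card) hne
      refine ⟨S₀, (Finset.mem_filter.mp hS₀mem).2, fun S hS => ?_⟩
      exact hS₀min S (Finset.mem_filter.mpr ⟨Finset.mem_univ _, hS⟩)
    have h := congrFun hc S₀
    simp only [Finset.sum_apply, Pi.smul_apply, smul_eq_mul, Pi.zero_apply] at h
    rw [Finset.sum_eq_single S₀] at h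
    · exact mul_ne_zero hS₀ (hdiag S₀) h
    · intro S _ hS
      by_cases hcS : c S = 0
      · rw [hcS, zero_mul]
      · rw [hoff S S₀ hS (hmin S hcS), mul_zero]
    · intro h0; exact absurd (Finset.mem_univ S₀) h0
  -- every vector lies in the span of the monomial vectors `(w_T^e)_T`, `deg e ≤ D`
  let mon : (σ →₀ ℕ) → (patterns f → F) := fun e T => ∏ j, w T j ^ e j
  let W : Submodule F (patterns f → F) := Submodule.span F ((degreeLEMonomials σ D).image mon)
  have hmem : ∀ S : patterns f, vec S ∈ W := by
    intro S
    have hrepr : vec S = ∑ e ∈ (g S).support, coeff e (g S) • mon e := by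
      funext T
      simp only [vec, Finset.sum_apply, Pi.smul_apply, smul_eq_mul, mon]
      exact eval_eq' (w T) (g S)
    rw [hrepr]
    refine Submodule.sum_mem _ fun e he => Submodule.smul_mem _ _ (Submodule.subset_span ?_)
    refine Finset.mem_image.mpr ⟨e, mem_degreeLEMonomials_of_sum_le ?_, rfl⟩
    have h1 : (e.sum fun _ k => k) ≤ (g S).totalDegree := le_totalDegree he
    exact h1.trans ((totalDegree_prod_le_sum f _).trans hD)
  -- count
  let vec' : patterns f → W := fun S => ⟨vec S, hmem S⟩
  have hli' : LinearIndependent F vec' := LinearIndependent.of_comp W.subtype hli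
  haveI : Module.Finite F W := Module.Finite.span_of_finite F (Finset.finite_toSet _)
  calc (patterns f).card = Fintype.card (patterns f) := (Fintype.card_coe _).symm
    _ ≤ Module.finrank F W := hli'.fintype_card_le_finrank
    _ ≤ ((degreeLEMonomials σ D).image mon).card := finrank_span_finset_le_card _
    _ ≤ (degreeLEMonomials σ D).card := Finset.card_image_le

/-- **Rónyai–Babai–Ganapathy, Thm. 1.1 (crude form)**: at most `(D+1)^n` zero-patterns for
polynomials in `n = #σ` variables with `Σ deg f_i ≤ D`. [cite: RonyaiBabaiGanapathy2001, Thm. 1.1] -/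
theorem card_patterns_le_pow [Fintype σ] [DecidableEq σ] (f : ι → MvPolynomial σ F) {D : ℕ}
    (hD : ∑ i, (f i).totalDegree ≤ D) :
    (patterns f).card ≤ (D + 1) ^ Fintype.card σ :=
  (card_patterns_le f hD).trans (card_degreeLEMonomials_le_pow σ D)

end RBG

end Literature.Combinatorics

end
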